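import Literature.AlgebraicGeometry.AbelianSchemes.SymplecticLiftOfIsogenyWeil
import Literature.AlgebraicGeometry.AbelianSchemes.IsLambdaOfAtAlongIsogeny
import Literature.AlgebraicGeometry.AbelianSchemes.IsLambdaOfAtAlongDualIsogeny
import Literature.AlgebraicGeometry.AbelianSchemes.AbelianSchemeQuotientMulNDescent
import HarnessLib

/-!
# The `symplectic` field of a Hecke isogeny quotient from the Poincaré clause and the descent identity
# ([Lan2013PELCompactifications] §1.3.6; [MumfordAV1970] §20, §23; [Deligne1971TravauxShimura] 4.11–4.12)

[MumfordAV1970, §23 Thm. 2 (p. 231)] / [MumfordFogartyKirwan1994, Ch. 6 §2 (6.3)]: for an isogeny `ψ : A → B` and line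
bundles, `Λ(ψ^*L) = ψ^∨ ∘ Λ(L) ∘ ψ`; so a polarisation `λ_B` of the quotient with `ψ^∨ ∘ λ_B ∘ ψ = ν·λ_A` has
`D_Q(ψ^*Θ_B) ∼ ν·D_Q(Θ_A)` for any `Λ(𝒪(·))`-witnesses `Θ_A`, `Θ_B` — in the tree ★ (α)
`AbelianSchemeOver.weilDiv_pullback_fibreHom_linEquiv_nsmul` (`IsLambdaOfAtAlongIsogeny`, with the dual morphism `ψ^∨`
entered through the POINCARÉ CLAUSE (e1) `(ψ × 1)^*𝒫_B ≅ (1 × ψ^∨)^*𝒫_A`).  Composed with ★ (γ1)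
`IsSymplecticLiftable.of_fibreIsogeny_of_weilDiv_linEquiv` (`SymplecticLiftOfIsogenyWeil` = ★ (T3) transport engine + ★ (W′)
mixed-level Weil clause) this closes the `symplectic` field of the Hecke isogeny-quotient triple at EVERY geometric point:

* `LevelStructure.IsSymplecticLiftable.of_fibreIsogeny_of_poincareClause` — liftability of type `δ` transfers from
  `(A, λ_A, φ′)` (level `N·ν`) to `(B, λ_B, u ∘ φ′^ν)` (level `N`) along `u : A → B` with Hecke kernel datum
  `(γ, γ⋆, ν, N)`, given `ud : B̂ → Â` with (e1) and (b) `u ≫ λ_B ≫ ud = λ_A^ν`;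
* `LevelStructure.exists_isSymplecticLiftable_of_fibreIsogeny_of_poincareClause` — with ★ H3, the `level` and
  `symplectic` fields in one call.
Inputs of the quotient construction that remain hypotheses here (supplied by the files constructing `B = A/K`, `λ_B`,
`ud`): `u` onto on geometric fibre points, the exact kernel `φ′(N·γ⋆ℤ^{2g})`, (e1), (b).  Theorems only; cell
hodgecm-mathlib, seat B-p04 (g17), E-road HECKE-LINK socket (B) (γ2).  HC_CM is proved only modulo the 7 printed citations
until rung 0 closes; this file discharges none of them.

## References
* [Lan2013PELCompactifications] K.-W. Lan, *Arithmetic compactifications of PEL-type Shimura varieties* (2013), §1.3.6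
  Def. 1.3.6.2 (p. 80), Lemma 1.3.6.6 and Cor. 1.3.6.7 (pp. 81–82).
* [MumfordAV1970] D. Mumford, *Abelian Varieties* (1970), §20 (3) (p. 186), §23 Thm. 2 (p. 231).
* [Deligne1971TravauxShimura] P. Deligne, *Travaux de Shimura* (1971), 4.11–4.12 (pp. 148–149).
* [MumfordFogartyKirwan1994] *Geometric Invariant Theory*, 3rd ed., Ch. 6 §2 (6.3) (p. 121), Ch. 7 §1 Def. 7.1 (p. 129).
-/

noncomputable section

universe u

open CategoryTheory CategoryTheory.Limits AlgebraicGeometry MonoidalCategory Matrix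
open scoped MonObj

/-! ### §1 The `symplectic` (+ `level`) field of the Hecke isogeny quotient from the Poincaré clause (e1) and the
descent identity (b) — the (γ2) closer -/

namespace Literature.AlgebraicGeometry.AbelianSchemes

namespace AbelianSchemeOver

open Matrix Literature.AlgebraicGeometry.Motives
open scoped MonObj
open Literature.AlgebraicGeometry.ModuliOfAbelianVarieties (typeForm)

variable {S : Scheme.{u}} {A B : AbelianSchemeOver S}

/-- **`Q.symplectic` FOR A HECKE ISOGENY QUOTIENT** ((γ2): ★ (γ1) `of_fibreIsogeny_of_weilDiv_linEquiv` ∘ ★ (α)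
`weilDiv_pullback_fibreHom_linEquiv_nsmul`): let `u : A → B` be a homomorphism of abelian schemes over `S`, onto on
geometric fibre points, `B` of relative dimension `g`, with the Hecke kernel datum `(γ, γ⋆, ν, N)` (`γγ⋆ = γ⋆γ = ν`,
`ᵗγ⋆E_δγ⋆ = νE_δ`, `γ ≡ 1 (mod N)`, kernel of `u_s` = `φ′(N·γ⋆ℤ^{2g})(s)` at every geometric point); let `ud : B̂ → Â` carry
the POINCARÉ CLAUSE (e1) `(u × 1)^*𝒫_B ≅ (1 × ud)^*𝒫_A` (through the two product maps `mψ`, `mψd`) and the DESCENT IDENTITY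
(b) `u ≫ λ_B ≫ ud = λ_A^ν`.  Then a symplectic-liftable level-`N·ν` structure `φ′` of type `δ` for `λ_A` makes the induced
level-`N` structure `ψφ = u ∘ φ′^ν` symplectic-liftable of type `δ` for `λ_B`: at a geometric point with ample witness `Θ_B`
of `λ̄_B`, any ample witness `Θ_A` of `λ̄_A` (★ `Polarization.exists_ample`) satisfies the divisor clause
`D_Q(u_s^*Θ_B) ∼ ν·D_Q(Θ_A)` by (α), and (γ1) concludes. [cite: Lan2013PELCompactifications, §1.3.6 Lemma 1.3.6.6 and Cor. 1.3.6.7 (pp. 81–82)]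
[cite: MumfordAV1970, §23 (Thm. 2, p. 231)] [cite: Deligne1971TravauxShimura, 4.11–4.12 pp. 148–149] -/
theorem LevelStructure.IsSymplecticLiftable.of_fibreIsogeny_of_poincareClause {g N ν : ℕ} (hN : N ≠ 0) (hν : ν ≠ 0)
    {φ' : A.LevelStructure g (N * ν)} {DA : A.DualPair} {polA : A.Polarization DA}
    {DB : B.DualPair} {polB : B.Polarization DB} {δ : Fin g → ℕ}
    (u : A.X ⟶ B.X) [IsMonHom u] {ψφ : B.LevelStructure g N} (hψφ : ∀ i, ψφ.σ i = (φ'.σ i ^ ν) ≫ u)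
    (hB : B.IsOfRelDim g)
    (γm γs : Matrix (Fin g ⊕ Fin g) (Fin g ⊕ Fin g) ℤ) (hγ : γm * γs = (ν : ℤ) • (1 : Matrix _ _ ℤ))
    (hγ' : γs * γm = (ν : ℤ) • (1 : Matrix _ _ ℤ)) (hsim : γsᵀ * typeForm δ * γs = (ν : ℤ) • typeForm δ)
    (hQA4 : ∀ k i, (N : ℤ) ∣ (γm - 1) k i)
    (hsurj : ∀ (Ω : Type u) [Field Ω] [IsAlgClosed Ω] (s : Spec (.of Ω) ⟶ S),
      Function.Surjective (AlgPoints.map (L := Ω) (fibreHom u s).hom.hom.hom))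
    (hker : ∀ (Ω : Type u) [Field Ω] [IsAlgClosed Ω] (s : Spec (.of Ω) ⟶ S)
      (P : (A.fibre s).toAbelianVariety.Points Ω), AlgPoints.map (fibreHom u s).hom.hom.hom P = 1 ↔
        ∃ z : Fin g ⊕ Fin g → ℤ,
          P = A.restrictPt s (φ'.section_ fun j => ((((N : ℤ) * (γs *ᵥ z) j : ℤ)) : ZMod (N * ν))))
    (ud : DB.hat.X ⟶ DA.hat.X)
    (mψ : A.prodLeft DB.hat ⟶ B.prodLeft DB.hat)
    (hmψ₁ : mψ ≫ pullback.fst B.X.hom DB.hat.X.hom = pullback.fst A.X.hom DB.hat.X.hom ≫ u.left)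
    (hmψ₂ : mψ ≫ pullback.snd B.X.hom DB.hat.X.hom = pullback.snd A.X.hom DB.hat.X.hom)
    (mψd : A.prodLeft DB.hat ⟶ A.prodLeft DA.hat)
    (hmψd₁ : mψd ≫ pullback.fst A.X.hom DA.hat.X.hom = pullback.fst A.X.hom DB.hat.X.hom)
    (hmψd₂ : mψd ≫ pullback.snd A.X.hom DA.hat.X.hom = pullback.snd A.X.hom DB.hat.X.hom ≫ ud.left)
    (eP : (Scheme.Modules.pullback mψ).obj DB.P ≅ (Scheme.Modules.pullback mψd).obj DA.P)
    (hb : u ≫ polB.lam ≫ ud = polA.lam ^ ν)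
    (h : φ'.IsSymplecticLiftable polA δ) : ψφ.IsSymplecticLiftable polB δ := by
  haveI := polA.isMonHom
  refine LevelStructure.IsSymplecticLiftable.of_fibreIsogeny_of_weilDiv_linEquiv hN hν u hψφ hB γm γs hγ hγ' hsim hQA4
    hsurj hker (fun Ω _ _ s _ ΘB _ hlamB => ?_) h
  obtain ⟨ΘA, hΘA, hlamA⟩ := polA.exists_ample Ω s
  exact ⟨ΘA, hΘA, hlamA, fun Q =>
    A.weilDiv_pullback_fibreHom_linEquiv_nsmul s B u DA DB polB.lam ud mψ hmψ₁ hmψ₂ mψd hmψd₁ hmψd₂ eP hb hlamA hlamB Q⟩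

/-- **The `level` and `symplectic` fields of the Hecke isogeny quotient, in one call** (★ H3 + the above).
[cite: Lan2013PELCompactifications, §1.3.6 Def. 1.3.6.2 (p. 80), Lemma 1.3.6.6 and Cor. 1.3.6.7 (pp. 81–82)]
[cite: MumfordFogartyKirwan1994, Ch. 7 §1 Definition 7.1 (p. 129) and App. 7A (p. 235)] -/
theorem LevelStructure.exists_isSymplecticLiftable_of_fibreIsogeny_of_poincareClause {g N ν : ℕ} (hN : N ≠ 0)
    (hν : ν ≠ 0) {φ' : A.LevelStructure g (N * ν)} {DA : A.DualPair} {polA : A.Polarization DA}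
    {DB : B.DualPair} {polB : B.Polarization DB} {δ : Fin g → ℕ}
    (u : A.X ⟶ B.X) [IsMonHom u] (hcop : Nat.Coprime ν N)
    (hsurjF : ∀ ⦃Ω : Type u⦄ [Field Ω] [IsAlgClosed Ω] (s : Spec (.of Ω) ⟶ S) (y : B.FibrePoints s),
      ∃ x : A.FibrePoints s, x ≫ u = y)
    (hkerν : ∀ ⦃Ω : Type u⦄ [Field Ω] [IsAlgClosed Ω] (s : Spec (.of Ω) ⟶ S) (x : A.FibrePoints s),
      x ≫ u = 1 → x ^ ν = 1)
    (hB : B.IsOfRelDim g)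
    (γm γs : Matrix (Fin g ⊕ Fin g) (Fin g ⊕ Fin g) ℤ) (hγ : γm * γs = (ν : ℤ) • (1 : Matrix _ _ ℤ))
    (hγ' : γs * γm = (ν : ℤ) • (1 : Matrix _ _ ℤ)) (hsim : γsᵀ * typeForm δ * γs = (ν : ℤ) • typeForm δ)
    (hQA4 : ∀ k i, (N : ℤ) ∣ (γm - 1) k i)
    (hsurj : ∀ (Ω : Type u) [Field Ω] [IsAlgClosed Ω] (s : Spec (.of Ω) ⟶ S),
      Function.Surjective (AlgPoints.map (L := Ω) (fibreHom u s).hom.hom.hom))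
    (hker : ∀ (Ω : Type u) [Field Ω] [IsAlgClosed Ω] (s : Spec (.of Ω) ⟶ S)
      (P : (A.fibre s).toAbelianVariety.Points Ω), AlgPoints.map (fibreHom u s).hom.hom.hom P = 1 ↔
        ∃ z : Fin g ⊕ Fin g → ℤ,
          P = A.restrictPt s (φ'.section_ fun j => ((((N : ℤ) * (γs *ᵥ z) j : ℤ)) : ZMod (N * ν))))
    (ud : DB.hat.X ⟶ DA.hat.X)
    (mψ : A.prodLeft DB.hat ⟶ B.prodLeft DB.hat)
    (hmψ₁ : mψ ≫ pullback.fst B.X.hom DB.hat.X.hom = pullback.fst A.X.hom DB.hat.X.hom ≫ u.left)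
    (hmψ₂ : mψ ≫ pullback.snd B.X.hom DB.hat.X.hom = pullback.snd A.X.hom DB.hat.X.hom)
    (mψd : A.prodLeft DB.hat ⟶ A.prodLeft DA.hat)
    (hmψd₁ : mψd ≫ pullback.fst A.X.hom DA.hat.X.hom = pullback.fst A.X.hom DB.hat.X.hom)
    (hmψd₂ : mψd ≫ pullback.snd A.X.hom DA.hat.X.hom = pullback.snd A.X.hom DB.hat.X.hom ≫ ud.left)
    (eP : (Scheme.Modules.pullback mψ).obj DB.P ≅ (Scheme.Modules.pullback mψd).obj DA.P)
    (hb : u ≫ polB.lam ≫ ud = polA.lam ^ ν)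
    (h : φ'.IsSymplecticLiftable polA δ) :
    ∃ ψ : B.LevelStructure g N, (∀ i, ψ.σ i = (φ'.σ i ^ ν) ≫ u) ∧ ψ.IsSymplecticLiftable polB δ := by
  obtain ⟨ψ, hψ⟩ := φ'.exists_σ_eq_pow_comp_of_coprime (Nat.mul_ne_zero hN hν) u hcop hsurjF hkerν
  exact ⟨ψ, hψ, LevelStructure.IsSymplecticLiftable.of_fibreIsogeny_of_poincareClause hN hν u hψ hB γm γs hγ hγ' hsim
    hQA4 hsurj hker ud mψ hmψ₁ hmψ₂ mψd hmψd₁ hmψd₂ eP hb h⟩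

/-! ### §2 (ed. 2) The same with the TREE'S dual isogeny `ψ^∨ = DualPair.dualIsogenyOver u DA DB` — no Poincaré-clause
binders (★ `IsLambdaOfAtAlongDualIsogeny` discharges (e1) once and for all) -/

/-- **`Q.symplectic` FOR A HECKE ISOGENY QUOTIENT, dual-isogeny form** (ed. 2): as `of_fibreIsogeny_of_poincareClause`, with
`ud := DualPair.dualIsogenyOver u DA DB` (★ `AbelianSchemeDualIsogeny`: the dual homomorphism `B̂ → Â` classifying
`(u × 1)^*𝒫_B`) and the Poincaré clause (e1) supplied by ★ `DualPair.poincareClause_dualIsogeny`; the only polarisation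
input left is the DESCENT IDENTITY (b) `u ≫ λ_B ≫ u^∨ = λ_A^ν`. [cite: Lan2013PELCompactifications, §1.3.6 Lemma 1.3.6.6 and Cor. 1.3.6.7 (pp. 81–82)]
[cite: MumfordAV1970, §23 (Thm. 2, p. 231)] [cite: Deligne1971TravauxShimura, 4.11–4.12 pp. 148–149] -/
theorem LevelStructure.IsSymplecticLiftable.of_fibreIsogeny_of_dualIsogeny {g N ν : ℕ} (hN : N ≠ 0) (hν : ν ≠ 0)
    {φ' : A.LevelStructure g (N * ν)} {DA : A.DualPair} {polA : A.Polarization DA}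
    {DB : B.DualPair} {polB : B.Polarization DB} {δ : Fin g → ℕ}
    (u : A.X ⟶ B.X) [IsMonHom u] {ψφ : B.LevelStructure g N} (hψφ : ∀ i, ψφ.σ i = (φ'.σ i ^ ν) ≫ u)
    (hB : B.IsOfRelDim g)
    (γm γs : Matrix (Fin g ⊕ Fin g) (Fin g ⊕ Fin g) ℤ) (hγ : γm * γs = (ν : ℤ) • (1 : Matrix _ _ ℤ))
    (hγ' : γs * γm = (ν : ℤ) • (1 : Matrix _ _ ℤ)) (hsim : γsᵀ * typeForm δ * γs = (ν : ℤ) • typeForm δ)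
    (hQA4 : ∀ k i, (N : ℤ) ∣ (γm - 1) k i)
    (hsurj : ∀ (Ω : Type u) [Field Ω] [IsAlgClosed Ω] (s : Spec (.of Ω) ⟶ S),
      Function.Surjective (AlgPoints.map (L := Ω) (fibreHom u s).hom.hom.hom))
    (hker : ∀ (Ω : Type u) [Field Ω] [IsAlgClosed Ω] (s : Spec (.of Ω) ⟶ S)
      (P : (A.fibre s).toAbelianVariety.Points Ω), AlgPoints.map (fibreHom u s).hom.hom.hom P = 1 ↔
        ∃ z : Fin g ⊕ Fin g → ℤ,
          P = A.restrictPt s (φ'.section_ fun j => ((((N : ℤ) * (γs *ᵥ z) j : ℤ)) : ZMod (N * ν))))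
    (hb : u ≫ polB.lam ≫ DualPair.dualIsogenyOver u DA DB = polA.lam ^ ν)
    (h : φ'.IsSymplecticLiftable polA δ) : ψφ.IsSymplecticLiftable polB δ := by
  haveI := polA.isMonHom
  refine LevelStructure.IsSymplecticLiftable.of_fibreIsogeny_of_weilDiv_linEquiv hN hν u hψφ hB γm γs hγ hγ' hsim hQA4
    hsurj hker (fun Ω _ _ s _ ΘB _ hlamB => ?_) h
  obtain ⟨ΘA, hΘA, hlamA⟩ := polA.exists_ample Ω s
  exact ⟨ΘA, hΘA, hlamA, fun Q =>
    weilDiv_pullback_fibreHom_linEquiv_nsmul_dualIsogeny u DA DB s polB.lam hb hlamA hlamB Q⟩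

/-- **The `level` and `symplectic` fields of the Hecke isogeny quotient in one call, dual-isogeny form** (ed. 2; ★ H3 + the
above). [cite: Lan2013PELCompactifications, §1.3.6 Def. 1.3.6.2 (p. 80), Lemma 1.3.6.6 and Cor. 1.3.6.7 (pp. 81–82)]
[cite: MumfordFogartyKirwan1994, Ch. 7 §1 Definition 7.1 (p. 129) and App. 7A (p. 235)] -/
theorem LevelStructure.exists_isSymplecticLiftable_of_fibreIsogeny_of_dualIsogeny {g N ν : ℕ} (hN : N ≠ 0)
    (hν : ν ≠ 0) {φ' : A.LevelStructure g (N * ν)} {DA : A.DualPair} {polA : A.Polarization DA}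
    {DB : B.DualPair} {polB : B.Polarization DB} {δ : Fin g → ℕ}
    (u : A.X ⟶ B.X) [IsMonHom u] (hcop : Nat.Coprime ν N)
    (hsurjF : ∀ ⦃Ω : Type u⦄ [Field Ω] [IsAlgClosed Ω] (s : Spec (.of Ω) ⟶ S) (y : B.FibrePoints s),
      ∃ x : A.FibrePoints s, x ≫ u = y)
    (hkerν : ∀ ⦃Ω : Type u⦄ [Field Ω] [IsAlgClosed Ω] (s : Spec (.of Ω) ⟶ S) (x : A.FibrePoints s),
      x ≫ u = 1 → x ^ ν = 1)
    (hB : B.IsOfRelDim g)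
    (γm γs : Matrix (Fin g ⊕ Fin g) (Fin g ⊕ Fin g) ℤ) (hγ : γm * γs = (ν : ℤ) • (1 : Matrix _ _ ℤ))
    (hγ' : γs * γm = (ν : ℤ) • (1 : Matrix _ _ ℤ)) (hsim : γsᵀ * typeForm δ * γs = (ν : ℤ) • typeForm δ)
    (hQA4 : ∀ k i, (N : ℤ) ∣ (γm - 1) k i)
    (hsurj : ∀ (Ω : Type u) [Field Ω] [IsAlgClosed Ω] (s : Spec (.of Ω) ⟶ S),
      Function.Surjective (AlgPoints.map (L := Ω) (fibreHom u s).hom.hom.hom))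
    (hker : ∀ (Ω : Type u) [Field Ω] [IsAlgClosed Ω] (s : Spec (.of Ω) ⟶ S)
      (P : (A.fibre s).toAbelianVariety.Points Ω), AlgPoints.map (fibreHom u s).hom.hom.hom P = 1 ↔
        ∃ z : Fin g ⊕ Fin g → ℤ,
          P = A.restrictPt s (φ'.section_ fun j => ((((N : ℤ) * (γs *ᵥ z) j : ℤ)) : ZMod (N * ν))))
    (hb : u ≫ polB.lam ≫ DualPair.dualIsogenyOver u DA DB = polA.lam ^ ν)
    (h : φ'.IsSymplecticLiftable polA δ) :
    ∃ ψ : B.LevelStructure g N, (∀ i, ψ.σ i = (φ'.σ i ^ ν) ≫ u) ∧ ψ.IsSymplecticLiftable polB δ := by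
  obtain ⟨ψ, hψ⟩ := φ'.exists_σ_eq_pow_comp_of_coprime (Nat.mul_ne_zero hN hν) u hcop hsurjF hkerν
  exact ⟨ψ, hψ, LevelStructure.IsSymplecticLiftable.of_fibreIsogeny_of_dualIsogeny hN hν u hψ hB γm γs hγ hγ' hsim hQA4
    hsurj hker hb h⟩

/-! ### §3 (ed. 3) The descent identity (b) in the quotient construction's `.left`/`mulN` spelling -/

/-- **Bridge for export (b)**: the quotient construction states the descent identity on underlying scheme morphisms,
`ψ.left ≫ λ_B.left ≫ dualIsogeny ψ D_A D_B = λ_A.left ≫ (mulN ν).left` (`mulN ν = (𝟙 Â)^ν`, ★ `AbelianSchemeQuotientMulNDescent`);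
this is the `Over`-level identity `ψ ≫ λ_B ≫ ψ^∨ = λ_A^ν` consumed above (an `S`-morphism is determined by its underlying
morphism; `λ ≫ (𝟙)^ν = λ^ν`, Mathlib `MonObj.comp_pow`). [cite: MumfordAV1970, §23 (Thm. 2, p. 231)] -/
theorem comp_comp_dualIsogenyOver_eq_pow_of_left {DA : A.DualPair} {DB : B.DualPair} (u : A.X ⟶ B.X) [IsMonHom u]
    (lamA : A.X ⟶ DA.hat.X) (lamB : B.X ⟶ DB.hat.X) (ν : ℕ)
    (h : u.left ≫ lamB.left ≫ DualPair.dualIsogeny u DA DB = lamA.left ≫ (DA.hat.mulN ν).left) :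
    u ≫ lamB ≫ DualPair.dualIsogenyOver u DA DB = lamA ^ ν := by
  have hpow : lamA ^ ν = lamA ≫ DA.hat.mulN ν := by
    rw [AbelianSchemeOver.mulN, MonObj.comp_pow, Category.comp_id]
  rw [hpow]
  ext : 1
  rw [Over.comp_left, Over.comp_left, Over.comp_left, DualPair.dualIsogenyOver_left]
  exact h

/-- **`Q.symplectic` of the Hecke isogeny quotient, `.left`/`mulN` form of (b)** (ed. 3): ★ `of_fibreIsogeny_of_dualIsogeny`
with the descent identity supplied as `u.left ≫ λ_B.left ≫ dualIsogeny u D_A D_B = λ_A.left ≫ (mulN ν).left` (the export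
spelling of the quotient-polarisation file). [cite: Lan2013PELCompactifications, §1.3.6 Lemma 1.3.6.6 and Cor. 1.3.6.7 (pp. 81–82)]
[cite: MumfordAV1970, §23 (Thm. 2, p. 231)] -/
theorem LevelStructure.IsSymplecticLiftable.of_fibreIsogeny_of_dualIsogeny_left {g N ν : ℕ} (hN : N ≠ 0) (hν : ν ≠ 0)
    {φ' : A.LevelStructure g (N * ν)} {DA : A.DualPair} {polA : A.Polarization DA}
    {DB : B.DualPair} {polB : B.Polarization DB} {δ : Fin g → ℕ}
    (u : A.X ⟶ B.X) [IsMonHom u] {ψφ : B.LevelStructure g N} (hψφ : ∀ i, ψφ.σ i = (φ'.σ i ^ ν) ≫ u)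
    (hB : B.IsOfRelDim g)
    (γm γs : Matrix (Fin g ⊕ Fin g) (Fin g ⊕ Fin g) ℤ) (hγ : γm * γs = (ν : ℤ) • (1 : Matrix _ _ ℤ))
    (hγ' : γs * γm = (ν : ℤ) • (1 : Matrix _ _ ℤ)) (hsim : γsᵀ * typeForm δ * γs = (ν : ℤ) • typeForm δ)
    (hQA4 : ∀ k i, (N : ℤ) ∣ (γm - 1) k i)
    (hsurj : ∀ (Ω : Type u) [Field Ω] [IsAlgClosed Ω] (s : Spec (.of Ω) ⟶ S),
      Function.Surjective (AlgPoints.map (L := Ω) (fibreHom u s).hom.hom.hom))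
    (hker : ∀ (Ω : Type u) [Field Ω] [IsAlgClosed Ω] (s : Spec (.of Ω) ⟶ S)
      (P : (A.fibre s).toAbelianVariety.Points Ω), AlgPoints.map (fibreHom u s).hom.hom.hom P = 1 ↔
        ∃ z : Fin g ⊕ Fin g → ℤ,
          P = A.restrictPt s (φ'.section_ fun j => ((((N : ℤ) * (γs *ᵥ z) j : ℤ)) : ZMod (N * ν))))
    (hb : u.left ≫ polB.lam.left ≫ DualPair.dualIsogeny u DA DB = polA.lam.left ≫ (DA.hat.mulN ν).left)
    (h : φ'.IsSymplecticLiftable polA δ) : ψφ.IsSymplecticLiftable polB δ :=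
  LevelStructure.IsSymplecticLiftable.of_fibreIsogeny_of_dualIsogeny hN hν u hψφ hB γm γs hγ hγ' hsim hQA4 hsurj hker
    (comp_comp_dualIsogenyOver_eq_pow_of_left u polA.lam polB.lam ν hb) h

end AbelianSchemeOver

end Literature.AlgebraicGeometry.AbelianSchemes

end
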